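import Summits.Ventures.PercRepro.SixFourResidueTwoPointsB

/-!
# PercRepro — C-025 at `(6,4)`: «plane + two points» solids at `t = 4`, part C (p2, gen 8 — Theorem 21.6): `k(S)` of
a triple / of a larger set, the share sum `Σ c(S) ≥ (13/10)·T + 4·D₃ − (5/3)·LP`, the demand count, and the bridges
`Tcnt_eq`, `D3cnt_eq`, `card_four_eq` to the line profile.
-/

namespace PercRepro.SixFour

open Finset ThmH

variable {α : Type*} [DecidableEq α] {M : Matroid α} [M.Finite] {G : Finset α}

/-! ## The share sum and the demand count in terms of `T`, `D₃`, `LP` -/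

section Counts

variable (hs : Simple M) {τ : Finset α} (hτ : τ ⊆ gr M)
include hs hτ

omit hs hτ in
/-- A triple of rank `3` has `k = 3`. -/
theorem kcol_eq_three_of_card_three {S : Finset α} (hc : S.card = 3) : kcol M S = 3 := by
  unfold kcol
  rw [Finset.filter_true_of_mem, hc]
  intro y hy
  have h2 : (S.erase y).card = 2 := by rw [Finset.card_erase_of_mem hy, hc]
  have h := M.eRk_le_encard ((S.erase y : Finset α) : Set α)
  rw [Set.encard_coe_eq_coe_finsetCard, h2] at h
  exact h

/-- A rank-`3` set with `≥ 4` points has `k ≤ 1`: two points whose removal leaves a collinear set would leave sets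
sharing `≥ 2` points, hence on one line, hence `S` collinear. -/
theorem kcol_le_one_of_four_le {S : Finset α} (hS : S ⊆ τ) (hr3 : M.eRk (S : Set α) = 3) (hc : 4 ≤ S.card) :
    kcol M S ≤ 1 := by
  unfold kcol
  rw [Finset.card_le_one]
  intro y hy y' hy'
  rw [Finset.mem_filter] at hy hy'
  by_contra hne
  -- two common points of `S ∖ y` and `S ∖ y′`
  have hcard : 2 ≤ ((S.erase y).erase y').card := by
    rw [Finset.card_erase_of_mem (Finset.mem_erase.2 ⟨fun h => hne h.symm, hy'.1⟩), Finset.card_erase_of_mem hy.1]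
    omega
  obtain ⟨u, hu, v, hv, huv⟩ := Finset.one_lt_card.1 (by omega : 1 < ((S.erase y).erase y').card)
  have huy : u ∈ S.erase y := (Finset.mem_erase.1 hu).2
  have hvy : v ∈ S.erase y := (Finset.mem_erase.1 hv).2
  have huy' : u ∈ S.erase y' := Finset.mem_erase.2 ⟨(Finset.mem_erase.1 hu).1, (Finset.mem_erase.1 huy).2⟩
  have hvy' : v ∈ S.erase y' := Finset.mem_erase.2 ⟨(Finset.mem_erase.1 hv).1, (Finset.mem_erase.1 hvy).2⟩
  have hSg : S ⊆ gr M := hS.trans hτ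
  have e1 := closure_pair_eq_of_eRk_le_two hs ((Finset.erase_subset y S).trans hSg) hy.2 huy hvy huv
  have e2 := closure_pair_eq_of_eRk_le_two hs ((Finset.erase_subset y' S).trans hSg) hy'.2 huy' hvy' huv
  -- `S ⊆ cl(S ∖ y)`: the points of `S ∖ y` trivially, and `y ∈ S ∖ y′ ⊆ cl(S ∖ y′) = cl(S ∖ y)`
  have hsub : (S : Set α) ⊆ M.closure ((S.erase y : Finset α) : Set α) := by
    intro z hz
    rw [Finset.mem_coe] at hz
    by_cases hzy : z = y
    · subst hzy
      have : z ∈ M.closure ((S.erase y' : Finset α) : Set α) :=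
        M.subset_closure _ (by rw [← coe_gr]; exact_mod_cast (Finset.erase_subset y' S).trans hSg)
          (Finset.mem_coe.2 (Finset.mem_erase.2 ⟨fun h => hne h, hz⟩))
      rw [← e2, e1] at this
      exact this
    · exact M.subset_closure _ (by rw [← coe_gr]; exact_mod_cast (Finset.erase_subset y S).trans hSg)
        (Finset.mem_coe.2 (Finset.mem_erase.2 ⟨hzy, hz⟩))
  have h3 : M.eRk (S : Set α) ≤ 2 := by
    calc M.eRk (S : Set α) ≤ M.eRk (M.closure ((S.erase y : Finset α) : Set α)) := M.eRk_mono hsub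
      _ = M.eRk ((S.erase y : Finset α) : Set α) := M.eRk_closure_eq _
      _ ≤ 2 := hy.2
  rw [hr3] at h3
  exact absurd h3 (by decide)

omit hs hτ in
/-- `c(S) = 13/10` for a triple. -/
theorem shareC_eq_of_card_three {S : Finset α} (hc : S.card = 3) : shareC M S = 13 / 10 := by
  unfold shareC
  rw [kcol_eq_three_of_card_three hc]
  norm_num

/-- `c(S) ≥ 7/3` for a rank-`3` set with `≥ 4` points, and `= 4` when `k = 0`. -/
theorem shareC_ge_of_four_le {S : Finset α} (hS : S ⊆ τ) (hr3 : M.eRk (S : Set α) = 3) (hc : 4 ≤ S.card) :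
    (if kcol M S = 1 then (7 / 3 : ℚ) else 4) ≤ shareC M S := by
  have hk := kcol_le_one_of_four_le hs hτ hS hr3 hc
  unfold shareC
  split_ifs with h1
  · rw [h1]; norm_num
  · have h0 : kcol M S = 0 := by omega
    rw [h0]; norm_num

/-- The independent triples, the rank-`3` sets with `≥ 4` points and the line-plus-point sets of `τ`. -/
noncomputable def Tcnt (M : Matroid α) [M.Finite] (τ : Finset α) : ℕ := ((R3 M τ).filter (fun S => S.card = 3)).card

/-- `#{S ∈ R₃(τ) : |S| ≥ 4}`. -/
noncomputable def D3cnt (M : Matroid α) [M.Finite] (τ : Finset α) : ℕ := ((R3 M τ).filter (fun S => 4 ≤ S.card)).card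

/-- `#{S ∈ R₃(τ) : |S| ≥ 4, k(S) = 1}` (the line-plus-point sets). -/
noncomputable def LPcnt (M : Matroid α) [M.Finite] (τ : Finset α) : ℕ :=
  ((R3 M τ).filter (fun S => 4 ≤ S.card ∧ kcol M S = 1)).card

/-- **The share sum**: `(13/10)·T + 4·D₃ − (5/3)·LP ≤ Σ_{S ∈ R₃(τ)} c(S)`. -/
theorem share_sum_ge : (13 / 10 : ℚ) * Tcnt M τ + 4 * D3cnt M τ - 5 / 3 * LPcnt M τ ≤ ∑ S ∈ R3 M τ, shareC M S := by
  -- pointwise: `g S ≤ c S` with `g = 13/10 / 7/3 / 4`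
  have hpt : ∀ S ∈ R3 M τ, (if S.card = 3 then (13 / 10 : ℚ) else if 4 ≤ S.card ∧ kcol M S = 1 then 7 / 3 else 4)
      ≤ shareC M S := by
    intro S hS
    obtain ⟨hSτ, hr3⟩ := mem_R3.1 hS
    have h3 : 3 ≤ S.card := three_le_card_of_eRk_eq_three hr3
    split_ifs with hc h41
    · exact (shareC_eq_of_card_three hc).ge
    · have := shareC_ge_of_four_le hs hτ hSτ hr3 h41.1
      rw [if_pos h41.2] at this
      exact this
    · have := shareC_ge_of_four_le hs hτ hSτ hr3 (by omega)
      rw [if_neg (fun h => h41 ⟨by omega, h⟩)] at this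
      exact this
  refine le_trans ?_ (Finset.sum_le_sum hpt)
  -- the sum of `g`
  rw [Finset.sum_ite, Finset.sum_const, Finset.sum_ite, Finset.sum_const, Finset.sum_const, nsmul_eq_mul, nsmul_eq_mul,
    nsmul_eq_mul]
  unfold Tcnt D3cnt LPcnt
  have hA : ((R3 M τ).filter (fun S => ¬ S.card = 3)).filter (fun S => 4 ≤ S.card ∧ kcol M S = 1) =
      (R3 M τ).filter (fun S => 4 ≤ S.card ∧ kcol M S = 1) := by
    rw [Finset.filter_filter]
    refine Finset.filter_congr (fun S hS => ?_)
    constructor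
    · exact fun h => h.2
    · exact fun h => ⟨by omega, h⟩
  have hB : ((R3 M τ).filter (fun S => ¬ S.card = 3)).filter (fun S => ¬ (4 ≤ S.card ∧ kcol M S = 1)) =
      ((R3 M τ).filter (fun S => 4 ≤ S.card)).filter (fun S => ¬ (kcol M S = 1)) := by
    rw [Finset.filter_filter, Finset.filter_filter]
    refine Finset.filter_congr (fun S hS => ?_)
    have h3 : 3 ≤ S.card := three_le_card_of_eRk_eq_three (mem_R3.1 hS).2
    constructor
    · rintro ⟨hne, hn⟩
      refine ⟨by omega, fun h1 => hn ⟨by omega, h1⟩⟩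
    · rintro ⟨h4, hn⟩
      exact ⟨by omega, fun h => hn h.2⟩
  rw [hA, hB]
  have hsplit := Finset.card_filter_add_card_filter_not (s := (R3 M τ).filter (fun S => 4 ≤ S.card))
    (fun S : Finset α => kcol M S = 1)
  rw [Finset.filter_filter] at hsplit
  have hsplit' : ((R3 M τ).filter (fun S => 4 ≤ S.card ∧ kcol M S = 1)).card +
      (((R3 M τ).filter (fun S => 4 ≤ S.card)).filter (fun S => ¬ kcol M S = 1)).card =
      ((R3 M τ).filter (fun S => 4 ≤ S.card)).card := by
    rw [← hsplit, Finset.filter_filter]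
  have hq : ((((R3 M τ).filter (fun S => 4 ≤ S.card)).filter (fun S => ¬ kcol M S = 1)).card : ℚ) =
      ((R3 M τ).filter (fun S => 4 ≤ S.card)).card - ((R3 M τ).filter (fun S => 4 ≤ S.card ∧ kcol M S = 1)).card := by
    rw [← hsplit']
    push_cast
    ring
  rw [hq]
  ring_nf
  linarith

omit hs hτ in
/-- **The demand count**: `Σ_{S ∈ R₃(τ)} dem(S) ≤ #{S ∈ R₃(τ) : |S| + 3 ≤ p}`. -/
theorem dem_sum_le :
    ∑ S ∈ R3 M τ, dem M τ S ≤ ((R3 M τ).filter (fun S => S.card + 3 ≤ τ.card)).card := by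
  have hpt : ∀ S ∈ R3 M τ, dem M τ S ≤ (if S.card + 3 ≤ τ.card then (1 : ℚ) else 0) := by
    intro S hS
    obtain ⟨hSτ, -⟩ := mem_R3.1 hS
    unfold dem
    split_ifs with h1 h2 h2
    · norm_num
    · norm_num
    · norm_num
    · exfalso
      apply h1
      -- `r(τ ∖ S) ≤ |τ ∖ S| = p − |S| ≤ 2`
      have hle := M.eRk_le_encard ((τ \ S : Finset α) : Set α)
      rw [Set.encard_coe_eq_coe_finsetCard, Finset.card_sdiff_of_subset hSτ] at hle
      have hc : τ.card - S.card ≤ 2 := by omega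
      calc M.eRk ((τ \ S : Finset α) : Set α) + 2 ≤ ((τ.card - S.card : ℕ) : ℕ∞) + 2 := add_le_add_left hle 2
        _ ≤ ((2 : ℕ) : ℕ∞) + 2 := add_le_add_left (by exact_mod_cast hc) 2
        _ = 4 := by norm_num
  refine (Finset.sum_le_sum hpt).trans ?_
  rw [Finset.sum_ite, Finset.sum_const, Finset.sum_const_zero, add_zero, nsmul_eq_mul, mul_one]

/-! ### The bridges to the line profile -/

/-- `T = C(p,3) − Σ_m inc_m·C(m,3)` (profile form, `p ≤ 7`). -/
theorem Tcnt_eq (hr : M.eRk (τ : Set α) = 3) (h7 : τ.card ≤ 7) :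
    (Tcnt M τ : ℤ) = TProf τ.card (inc M τ 3) (inc M τ 4) (inc M τ 5) (inc M τ 6) := by
  have e1 : Tcnt M τ = ((τ.powersetCard 3).filter (fun Z : Finset α => M.eRk (Z : Set α) = 3)).card := by
    unfold Tcnt R3
    rw [Finset.powersetCard_eq_filter, Finset.filter_filter, Finset.filter_filter]
    congr 1
    exact Finset.filter_congr (fun Z _ => and_comm)
  have hsplit := Finset.card_filter_add_card_filter_not (s := τ.powersetCard 3)
    (fun Z : Finset α => M.eRk (Z : Set α) = 3)
  have hcongr : (τ.powersetCard 3).filter (fun Z : Finset α => ¬ M.eRk (Z : Set α) = 3) =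
      (τ.powersetCard 3).filter (fun Z : Finset α => M.eRk (Z : Set α) = 2) := by
    refine Finset.filter_congr (fun Z hZ => ?_)
    obtain ⟨hZτ, hc⟩ := Finset.mem_powersetCard.1 hZ
    have hle : M.eRk (Z : Set α) ≤ 3 := by rw [← hr]; exact M.eRk_mono (Finset.coe_subset.2 hZτ)
    constructor
    · intro hne
      refine le_antisymm ?_ (two_le_eRk_of_two_le_card hs hτ hZτ (by omega))
      by_contra h
      exact hne (eRk_eq_of_le_of_not_le (n := 2) hle h)
    · intro h2; rw [h2]; decide
  rw [hcongr, card_rank_two_subsets hs hτ (by norm_num : 2 ≤ 3), Finset.card_powersetCard] at hsplit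
  have e3 := sum_lines_eq_sum_inc (M := M) τ (fun n => n.choose 3)
  rw [e3, sum_inc_range_eight hr h7] at hsplit
  have hi7 : inc M τ 7 = 0 := inc_eq_zero_of_card_le hr (by omega)
  have hc : Nat.choose 0 3 = 0 ∧ Nat.choose 1 3 = 0 ∧ Nat.choose 2 3 = 0 ∧ Nat.choose 3 3 = 1 ∧ Nat.choose 4 3 = 4 ∧
      Nat.choose 5 3 = 10 ∧ Nat.choose 6 3 = 20 := by decide
  obtain ⟨c0, c1, c2, c3, c4, c5, c6⟩ := hc
  simp only [Finset.sum_range_succ, Finset.sum_range_zero, c0, c1, c2, c3, c4, c5, c6, hi7, mul_zero, zero_add,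
    mul_one, zero_mul, add_zero] at hsplit
  unfold TProf
  rw [e1]
  omega

/-- `D₃cnt = D3Prof` (p3's `D3_add_sum_delta` in the present spelling, `p ≤ 7`). -/
theorem D3cnt_eq (hr : M.eRk (τ : Set α) = 3) (h7 : τ.card ≤ 7) :
    D3cnt M τ = D3Prof τ.card (inc M τ 4) (inc M τ 5) (inc M τ 6) := by
  have e1 : D3cnt M τ = (τ.powerset.filter (fun Z : Finset α => 4 ≤ Z.card ∧ M.eRk (Z : Set α) = 3)).card := by
    unfold D3cnt R3
    rw [Finset.filter_filter]
    congr 1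
    exact Finset.filter_congr (fun Z _ => and_comm)
  obtain ⟨d0, d1, d2, d3, d4, d5, d6⟩ := delta_values
  have hD := D3_add_sum_delta hs hτ hr
  have eD := sum_lines_eq_sum_inc (M := M) τ (fun n => delta n)
  rw [eD, sum_inc_range_eight hr h7] at hD
  have hi7 : inc M τ 7 = 0 := inc_eq_zero_of_card_le hr (by omega)
  simp only [Finset.sum_range_succ, Finset.sum_range_zero, d0, d1, d2, d3, d4, d5, d6, hi7, mul_zero, zero_add,
    mul_one, zero_mul, add_zero] at hD
  unfold D3Prof
  rw [d4, d5, d6, e1]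
  omega

/-- `#{S ∈ R₃(τ) : |S| = 4} = r34Prof` (p3's `r34_eq_r34Prof` in the present spelling). -/
theorem card_four_eq (hr : M.eRk (τ : Set α) = 3) (h7 : τ.card ≤ 7) :
    ((R3 M τ).filter (fun S => S.card = 4)).card = r34Prof τ.card (inc M τ 4) (inc M τ 5) (inc M τ 6) := by
  have e1 : ((R3 M τ).filter (fun S => S.card = 4)).card =
      ((τ.powersetCard 4).filter (fun Z : Finset α => M.eRk (Z : Set α) = 3)).card := by
    unfold R3
    rw [Finset.powersetCard_eq_filter, Finset.filter_filter, Finset.filter_filter]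
    congr 1
    exact Finset.filter_congr (fun Z _ => and_comm)
  have hsplit := Finset.card_filter_add_card_filter_not (s := τ.powersetCard 4)
    (fun Z : Finset α => M.eRk (Z : Set α) = 3)
  have hcongr : (τ.powersetCard 4).filter (fun Z : Finset α => ¬ M.eRk (Z : Set α) = 3) =
      (τ.powersetCard 4).filter (fun Z : Finset α => M.eRk (Z : Set α) = 2) := by
    refine Finset.filter_congr (fun Z hZ => ?_)
    obtain ⟨hZτ, hc⟩ := Finset.mem_powersetCard.1 hZ
    have hle : M.eRk (Z : Set α) ≤ 3 := by rw [← hr]; exact M.eRk_mono (Finset.coe_subset.2 hZτ)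
    constructor
    · intro hne
      refine le_antisymm ?_ (two_le_eRk_of_two_le_card hs hτ hZτ (by omega))
      by_contra h
      exact hne (eRk_eq_of_le_of_not_le (n := 2) hle h)
    · intro h2; rw [h2]; decide
  rw [hcongr, card_rank_two_subsets hs hτ (by norm_num : 2 ≤ 4), Finset.card_powersetCard] at hsplit
  have e4 := sum_lines_eq_sum_inc (M := M) τ (fun n => n.choose 4)
  rw [e4, sum_inc_range_eight hr h7] at hsplit
  have hi7 : inc M τ 7 = 0 := inc_eq_zero_of_card_le hr (by omega)
  have hc : Nat.choose 0 4 = 0 ∧ Nat.choose 1 4 = 0 ∧ Nat.choose 2 4 = 0 ∧ Nat.choose 3 4 = 0 ∧ Nat.choose 4 4 = 1 ∧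
      Nat.choose 5 4 = 5 ∧ Nat.choose 6 4 = 15 := by decide
  obtain ⟨c0, c1, c2, c3, c4, c5, c6⟩ := hc
  simp only [Finset.sum_range_succ, Finset.sum_range_zero, c0, c1, c2, c3, c4, c5, c6, hi7, mul_zero, zero_add,
    mul_one, zero_mul, add_zero] at hsplit
  unfold r34Prof
  rw [e1]
  omega

end Counts

end PercRepro.SixFour
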